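import Summits.Ventures.PackingBounds.Configurations.LeechCard4600
import Summits.Ventures.PackingBounds.Configurations.LeechSectionCount
import Summits.Ventures.PackingBounds.SphericalCodes.TouchingMutuallyTouchingSpheresExists

/-!
# Coordinate sections of the Leech minimal vectors, III: an antipodal pair — `A(17, arccos 1/3) ≥ 576`

Framing: lottery ticket; floor = certified bounds/negative ranges. Venture `PackingBounds` (cell `pub-packcert`,
seat `pub-packcert-sdp`), the ATTAINED side of the B2c cell `(17, 1/3)`, improving the pure coordinate-section row `512` of
`LeechPrefixSectionsThird.lean` (same seat).

For a set `J₀` of coordinates (all `≥ 4`) let `S'(J₀)` be the set of minimal vectors `y` of the Leech lattice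
(`√8`-scaling, `LeechVectors.lean`) with `y₀ = y₁ = 2`, **`y₂ + y₃ = 0`** and `y_j = 0` for `j ∈ J₀`. As in part I only
shape `B` occurs; an octad `o` through `0, 1` avoiding `J₀` contributes `32` vectors if it avoids `{2, 3}` (signs `+, +`
at `0, 1`, five free signs), `16` if it contains `{2, 3}` (opposite signs at `2, 3`: `card_patterns_00_23`), and nothing
if it contains exactly one of `2, 3` (then `y₂ + y₃ = ±2`): **`|S'(J₀)| = 32 · K₀ + 16 · K₂`** with two kernel octad
counts `K₀, K₂`. Deleting the coordinates `0, 1` (`cut2`) leaves integer vectors of norm `24` with pairwise inner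
products `≤ 8` (cosines `≤ 1/3`) which are orthogonal to `e₀, e₁, e₂ + e₃` and to `e_j`, `j ∈ J₀` — a subspace of
dimension `21 - |J₀|`; `SubspaceTransfer.exists_transfer_orthogonal` moves them to `ℝⁿ`
(`exists_code_third_pair_of_octads`, generic in `J₀`). Exhaustive search over `J₀` (seat file
`work/explore/pairsec.py`) gives the optima `32 K₀ + 16 K₂ = 1360, 960, 704, 576, 576, 368, 256, 176, 176` for
`|J₀| = 0, …, 8` (dimensions `21, …, 13`); this beats the pure coordinate sections of part I in dimensions `17` (`576 > 512`, `J₀ = {4, 13, 15, 20}`, `K₀ = 16`,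
`K₂ = 4`) and `13` (`176 > 128`), but in dimension `13` Construction A on `STS(13)` gives `208` (`CodesThirdConsASteiner.lean`),
so only the row **`A(17, arccos 1/3) ≥ 576`** is recorded here (kernel bracket with the Levenshtein column: `[576, 986]`; binary codes
give `A₂(17, 6) ≤ 340` and Construction A on a maximum triple packing of `17` points would give `8 · 44 = 352`; no value in
print was found — SPLAG Table 9.2 stops at `n = 10`; presearch corpus + galaxy).

## References
* J. H. Conway, N. J. A. Sloane, *Sphere Packings, Lattices and Groups*, 3rd ed., Ch. 4 §11 (the minimal vectors
  (135)), Ch. 10 §2 (octads), Ch. 14 Theorem 1. [`ConwaySloane1999`]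
-/

namespace Summit.Ventures.PackingBounds.Config.Leech.PrefixThirdPair

open Finset Golay Summit.Ventures.PackingBounds.Config.Leech

/-! ### The sections -/

/-- The section `S'(J₀)`: minimal vectors with `y₀ = y₁ = 2`, `y₂ + y₃ = 0`, vanishing on `J₀`. -/
noncomputable def sec (J0 : Finset (Fin 24)) : Finset (Fin 24 → ℤ) :=
  leechInt.filter fun y => ((y 0 = 2 ∧ y 1 = 2) ∧ y 2 + y 3 = 0) ∧ ∀ j ∈ J0, y j = 0

/-- Members of `S'(J₀)`. -/
theorem mem_sec {J0 : Finset (Fin 24)} {y : Fin 24 → ℤ} (hy : y ∈ sec J0) :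
    y ∈ leechInt ∧ ((y 0 = 2 ∧ y 1 = 2) ∧ y 2 + y 3 = 0) ∧ ∀ j ∈ J0, y j = 0 := by
  simpa [sec] using hy

/-! ### Shapes `A` and `C` contribute nothing (`y₀ = 2` is impossible for them) -/

/-- Shape `A`: no vector satisfies the condition. -/
theorem card_A (J0 : Finset (Fin 24)) :
    (idxA.filter fun p => (((avec p.1.1 p.1.2 p.2.1 p.2.2) 0 = 2 ∧ (avec p.1.1 p.1.2 p.2.1 p.2.2) 1 = 2) ∧
      (avec p.1.1 p.1.2 p.2.1 p.2.2) 2 + (avec p.1.1 p.1.2 p.2.1 p.2.2) 3 = 0) ∧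
      ∀ j ∈ J0, (avec p.1.1 p.1.2 p.2.1 p.2.2) j = 0).card = 0 := by
  rw [Finset.card_eq_zero, Finset.filter_eq_empty_iff]
  rintro p - ⟨⟨⟨h0, -⟩, -⟩, -⟩
  -- entries of a shape-`A` vector are `0, ±4, ±8`, never `2`
  revert h0
  unfold avec
  rcases sgn_cases p.2.1 with ha | ha <;> rcases sgn_cases p.2.2 with hb | hb <;> rw [ha, hb] <;> split_ifs <;> omega

/-- Shape `C`: no vector satisfies the condition. -/
theorem card_C (J0 : Finset (Fin 24)) :
    ((univ ×ˢ range 4096).filter fun p : Fin 24 × ℕ =>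
      ((((cvec p.1 p.2) 0 = 2 ∧ (cvec p.1 p.2) 1 = 2) ∧ (cvec p.1 p.2) 2 + (cvec p.1 p.2) 3 = 0) ∧
        ∀ j ∈ J0, (cvec p.1 p.2) j = 0)).card = 0 := by
  rw [Finset.card_eq_zero, Finset.filter_eq_empty_iff]
  rintro p - ⟨⟨⟨h0, -⟩, -⟩, -⟩
  -- entries of a shape-`C` vector are odd
  rcases cvec_apply_cases p.1 p.2 0 with ⟨_, h | h⟩ | ⟨_, h | h⟩ <;> omega

/-! ### Shape `B`: octads through `0, 1` avoiding `J₀` and either avoiding `{2, 3}` or containing it -/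

/-- On an octad containing `0, 1, 2, 3`, `y₂ + y₃ = 0` says the sign bits `2, 3` differ. -/
theorem bvec_23_iff_of_mem (o : Fin 759) (v : ℕ) (h0 : (0 : Fin 24) ∈ osupp o) (h1 : (1 : Fin 24) ∈ osupp o)
    (h2 : (2 : Fin 24) ∈ osupp o) (h3 : (3 : Fin 24) ∈ osupp o) :
    bvec o v 2 + bvec o v 3 = 0 ↔ v.testBit 2 ≠ v.testBit 3 := by
  have hp : ∀ j : Fin 24, j.val ≤ 3 → j ∈ osupp o := by
    intro j hj
    rcases Nat.lt_or_ge j.val 1 with h | h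
    · rw [show j = 0 from Fin.ext (by simp; omega)]; exact h0
    rcases Nat.lt_or_ge j.val 2 with h' | h'
    · rw [show j = 1 from Fin.ext (by simp; omega)]; exact h1
    rcases Nat.lt_or_ge j.val 3 with h'' | h''
    · rw [show j = 2 from Fin.ext (by simp; omega)]; exact h2
    · rw [show j = 3 from Fin.ext (by simp; omega)]; exact h3
  rw [bvec_apply_prefix o v (by norm_num) hp 2 (by decide), bvec_apply_prefix o v (by norm_num) hp 3 (by decide)]
  simp only [Fin.val_two, show (3 : Fin 24).val = 3 from rfl]
  cases v.testBit 2 <;> cases v.testBit 3 <;> simp [sgn]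

/-- The condition on shape `B`, as a disjoint union of two products. -/
theorem cond_bvec_iff (J0 : Finset (Fin 24)) (o : Fin 759) (v : ℕ) :
    ((((bvec o v) 0 = 2 ∧ (bvec o v) 1 = 2) ∧ (bvec o v) 2 + (bvec o v) 3 = 0) ∧ ∀ j ∈ J0, (bvec o v) j = 0) ↔
      (((((0 : Fin 24) ∈ osupp o ∧ (1 : Fin 24) ∈ osupp o) ∧ ((2 : Fin 24) ∉ osupp o ∧ (3 : Fin 24) ∉ osupp o)) ∧
          ∀ j ∈ J0, j ∉ osupp o) ∧ (v.testBit 0 = false ∧ v.testBit 1 = false)) ∨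
      (((((0 : Fin 24) ∈ osupp o ∧ (1 : Fin 24) ∈ osupp o) ∧ ((2 : Fin 24) ∈ osupp o ∧ (3 : Fin 24) ∈ osupp o)) ∧
          ∀ j ∈ J0, j ∉ osupp o) ∧ ((v.testBit 0 = false ∧ v.testBit 1 = false) ∧ v.testBit 2 ≠ v.testBit 3)) := by
  -- `y₀ = y₁ = 2` on shape `B` (= `PrefixThird.bvec_01_iff`, not importable yet)
  have h01iff : (bvec o v 0 = 2 ∧ bvec o v 1 = 2) ↔
      ((0 : Fin 24) ∈ osupp o ∧ (1 : Fin 24) ∈ osupp o) ∧ (v.testBit 0 = false ∧ v.testBit 1 = false) := by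
    rw [← bvec_nbr_iff, ip_x0]
    constructor
    · rintro ⟨h0, h1⟩; omega
    · intro h
      rcases bvec_apply_cases o v 0 with ⟨-, e0⟩ | ⟨-, e0 | e0⟩ <;>
        rcases bvec_apply_cases o v 1 with ⟨-, e1⟩ | ⟨-, e1 | e1⟩ <;> omega
  rw [h01iff]
  have hJ : (∀ j ∈ J0, bvec o v j = 0) ↔ ∀ j ∈ J0, j ∉ osupp o :=
    ⟨fun h j hj => (bvec_eq_zero_iff o v j).mp (h j hj), fun h j hj => (bvec_eq_zero_iff o v j).mpr (h j hj)⟩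
  rw [hJ]
  constructor
  · rintro ⟨⟨⟨h01, hv⟩, h23⟩, hJ0⟩
    rcases bvec_apply_cases o v 2 with ⟨m2, e2⟩ | ⟨m2, e2 | e2⟩ <;>
      rcases bvec_apply_cases o v 3 with ⟨m3, e3⟩ | ⟨m3, e3 | e3⟩ <;>
      first
        | exact Or.inl ⟨⟨⟨h01, m2, m3⟩, hJ0⟩, hv⟩
        | exact Or.inr ⟨⟨⟨h01, m2, m3⟩, hJ0⟩, hv, (bvec_23_iff_of_mem o v h01.1 h01.2 m2 m3).mp h23⟩
        | (exfalso; omega)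
  · rintro (⟨⟨⟨h01, m2, m3⟩, hJ0⟩, hv⟩ | ⟨⟨⟨h01, m2, m3⟩, hJ0⟩, hv, h23⟩)
    · refine ⟨⟨⟨h01, hv⟩, ?_⟩, hJ0⟩
      rw [(bvec_eq_zero_iff o v 2).mpr m2, (bvec_eq_zero_iff o v 3).mpr m3]; rfl
    · exact ⟨⟨⟨h01, hv⟩, (bvec_23_iff_of_mem o v h01.1 h01.2 m2 m3).mpr h23⟩, hJ0⟩

set_option maxRecDepth 100000 in
/-- `16` sign patterns are `+, +` at the positions `0, 1` and opposite at `2, 3`. -/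
theorem card_patterns_00_23 :
    ((range 128).filter fun v => (v.testBit 0 = false ∧ v.testBit 1 = false) ∧ v.testBit 2 ≠ v.testBit 3).card = 16 := by
  decide +kernel

/-- `32 · K₀ + 16 · K₂` shape-`B` vectors satisfy the condition. -/
theorem card_B (J0 : Finset (Fin 24)) {K0 K2 : ℕ}
    (hK0 : (univ.filter fun o : Fin 759 => (((0 : Fin 24) ∈ osupp o ∧ (1 : Fin 24) ∈ osupp o) ∧
      ((2 : Fin 24) ∉ osupp o ∧ (3 : Fin 24) ∉ osupp o)) ∧ ∀ j ∈ J0, j ∉ osupp o).card = K0)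
    (hK2 : (univ.filter fun o : Fin 759 => (((0 : Fin 24) ∈ osupp o ∧ (1 : Fin 24) ∈ osupp o) ∧
      ((2 : Fin 24) ∈ osupp o ∧ (3 : Fin 24) ∈ osupp o)) ∧ ∀ j ∈ J0, j ∉ osupp o).card = K2) :
    ((univ ×ˢ range 128).filter fun p : Fin 759 × ℕ =>
      ((((bvec p.1 p.2) 0 = 2 ∧ (bvec p.1 p.2) 1 = 2) ∧ (bvec p.1 p.2) 2 + (bvec p.1 p.2) 3 = 0) ∧
        ∀ j ∈ J0, (bvec p.1 p.2) j = 0)).card = 32 * K0 + 16 * K2 := by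
  rw [Finset.filter_congr (fun p _ => cond_bvec_iff J0 p.1 p.2), Finset.filter_or,
    Finset.card_union_of_disjoint]
  · rw [Finset.filter_product (fun o : Fin 759 => (((0 : Fin 24) ∈ osupp o ∧ (1 : Fin 24) ∈ osupp o) ∧
          ((2 : Fin 24) ∉ osupp o ∧ (3 : Fin 24) ∉ osupp o)) ∧ ∀ j ∈ J0, j ∉ osupp o)
        (fun v : ℕ => v.testBit 0 = false ∧ v.testBit 1 = false),
      Finset.filter_product (fun o : Fin 759 => (((0 : Fin 24) ∈ osupp o ∧ (1 : Fin 24) ∈ osupp o) ∧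
          ((2 : Fin 24) ∈ osupp o ∧ (3 : Fin 24) ∈ osupp o)) ∧ ∀ j ∈ J0, j ∉ osupp o)
        (fun v : ℕ => (v.testBit 0 = false ∧ v.testBit 1 = false) ∧ v.testBit 2 ≠ v.testBit 3),
      card_product, card_product, hK0, hK2, card_patterns_00, card_patterns_00_23]
    ring
  · rw [Finset.disjoint_filter]
    rintro p - ⟨⟨⟨-, h2, -⟩, -⟩, -⟩ ⟨⟨⟨-, h2', -⟩, -⟩, -⟩
    exact h2 h2'

/-- **`|S'(J₀)| = 32 · K₀ + 16 · K₂`.** [cite: ConwaySloane1999, Ch. 4 §11 (135)] -/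
theorem card_sec (J0 : Finset (Fin 24)) {K0 K2 : ℕ}
    (hK0 : (univ.filter fun o : Fin 759 => (((0 : Fin 24) ∈ osupp o ∧ (1 : Fin 24) ∈ osupp o) ∧
      ((2 : Fin 24) ∉ osupp o ∧ (3 : Fin 24) ∉ osupp o)) ∧ ∀ j ∈ J0, j ∉ osupp o).card = K0)
    (hK2 : (univ.filter fun o : Fin 759 => (((0 : Fin 24) ∈ osupp o ∧ (1 : Fin 24) ∈ osupp o) ∧
      ((2 : Fin 24) ∈ osupp o ∧ (3 : Fin 24) ∈ osupp o)) ∧ ∀ j ∈ J0, j ∉ osupp o).card = K2) :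
    (sec J0).card = 32 * K0 + 16 * K2 := by
  rw [sec, card_filter_leechInt (fun y => ((y 0 = 2 ∧ y 1 = 2) ∧ y 2 + y 3 = 0) ∧ ∀ j ∈ J0, y j = 0) (card_A J0)
    (card_B J0 hK0 hK2) (card_C J0)]
  omega

/-! ### Deleting the coordinates `0, 1` -/

/-- `y` with the coordinates `0, 1` set to `0` (integer, norm `24` on the sections). -/
def cut2 (y : Fin 24 → ℤ) : Fin 24 → ℤ := fun j => if j.val < 2 then 0 else y j

/-- Inner products after the cut. -/
theorem ip_cut2 (y y' : Fin 24 → ℤ) : ip (cut2 y) (cut2 y') = ip y y' - (y 0 * y' 0 + y 1 * y' 1) := by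
  simp [ip, cut2, Fin.sum_univ_succ]

/-- `cut2` is injective on each section. -/
theorem cut2_injOn (J0 : Finset (Fin 24)) : Set.InjOn cut2 ↑(sec J0) := by
  intro y hy y' hy' h
  obtain ⟨_, ⟨⟨a0, a1⟩, -⟩, -⟩ := mem_sec (Finset.mem_coe.mp hy)
  obtain ⟨_, ⟨⟨b0, b1⟩, -⟩, -⟩ := mem_sec (Finset.mem_coe.mp hy')
  funext j
  by_cases hj : j.val < 2
  · have : j = 0 ∨ j = 1 := by
      rcases Nat.lt_or_ge j.val 1 with h | h
      · exact Or.inl (Fin.ext (by simp; omega))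
      · exact Or.inr (Fin.ext (by simp; omega))
    rcases this with rfl | rfl <;> omega
  · have := congrFun h j
    simpa [cut2, hj] using this

/-- The cut, normalised section (in `ℝ²⁴`). -/
noncomputable def pre (J0 : Finset (Fin 24)) : Finset (EuclideanSpace ℝ (Fin 24)) :=
  (sec J0).image fun y => toE 24 (cut2 y)

/-- `|pre J₀| = |S'(J₀)|`. -/
theorem card_pre (J0 : Finset (Fin 24)) : (pre J0).card = (sec J0).card := by
  rw [pre, card_image_of_injOn]
  intro y hy y' hy' h
  exact cut2_injOn J0 hy hy' (toE_injective (by norm_num) h)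

/-- The cut vectors are unit vectors after scaling by `1/√24`. -/
theorem norm_pre (J0 : Finset (Fin 24)) : ∀ x ∈ pre J0, ‖x‖ = 1 := by
  intro x hx
  obtain ⟨y, hy, rfl⟩ := mem_image.mp hx
  obtain ⟨hL, ⟨⟨h0, h1⟩, -⟩, -⟩ := mem_sec hy
  refine norm_toE (by norm_num) ?_
  rw [ip_cut2, ip_self_of_mem hL, h0, h1]; norm_num

/-- Distinct cut vectors have inner product `≤ 1/3`. -/
theorem inner_pre (J0 : Finset (Fin 24)) : ∀ x ∈ pre J0, ∀ x' ∈ pre J0, x ≠ x' → inner ℝ x x' ≤ 1 / 3 := by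
  intro x hx x' hx' hne
  obtain ⟨y, hy, rfl⟩ := mem_image.mp hx
  obtain ⟨y', hy', rfl⟩ := mem_image.mp hx'
  obtain ⟨hL, ⟨⟨h0, h1⟩, -⟩, -⟩ := mem_sec hy
  obtain ⟨hL', ⟨⟨h0', h1'⟩, -⟩, -⟩ := mem_sec hy'
  have hyy : y ≠ y' := fun h => hne (by rw [h])
  rw [inner_toE (by norm_num), ip_cut2, h0, h1, h0', h1', div_le_iff₀ (by norm_num)]
  have h16 : (ip y y' : ℝ) ≤ 16 := by exact_mod_cast ip_le_of_mem hL hL' hyy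
  push_cast
  linarith

/-! ### Normals `e₂ + e₃`, `e₀`, `e₁`, `e_j (j ∈ J₀)` and the transfer to `ℝⁿ` -/

/-- The coordinate vector `e_j` (integer coordinates). -/
def e (j : Fin 24) : Fin 24 → ℤ := fun i => if i = j then 1 else 0

/-- Testing against `e_j` reads off the coordinate. -/
theorem ip_e (j : Fin 24) (y : Fin 24 → ℤ) : ip (e j) y = y j := by
  simp [ip, e]

/-- The vector `e₂ + e₃` (integer coordinates). -/
def e23 : Fin 24 → ℤ := fun i => if i = 2 ∨ i = 3 then 1 else 0

/-- Testing against `e₂ + e₃`. -/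
theorem ip_e23 (y : Fin 24 → ℤ) : ip e23 y = y 2 + y 3 := by
  simp [ip, e23, Fin.sum_univ_succ]

/-- The vanishing set `{0, 1} ∪ J₀` of the cut vectors. -/
def zset (J0 : Finset (Fin 24)) : Finset (Fin 24) := (univ.filter fun j : Fin 24 => j.val < 2) ∪ J0

/-- The cut vectors vanish on `zset J₀`. -/
theorem cut2_apply_eq_zero {J0 : Finset (Fin 24)} {y : Fin 24 → ℤ} (hy : y ∈ sec J0) {j : Fin 24}
    (hj : j ∈ zset J0) : cut2 y j = 0 := by
  obtain ⟨_, -, hJ⟩ := mem_sec hy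
  rcases Finset.mem_union.mp hj with h | h
  · have h' := (Finset.mem_filter.mp h).2
    simp [cut2, h']
  · by_cases h' : j.val < 2
    · simp [cut2, h']
    · simp [cut2, h', hJ j h]

/-- `y₂ + y₃ = 0` survives the cut. -/
theorem ip_e23_cut2 {J0 : Finset (Fin 24)} {y : Fin 24 → ℤ} (hy : y ∈ sec J0) : ip e23 (cut2 y) = 0 := by
  obtain ⟨_, ⟨-, h23⟩, -⟩ := mem_sec hy
  rw [ip_e23]
  simp only [cut2, Fin.val_two, show (3 : Fin 24).val = 3 from rfl]
  norm_num
  exact h23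

/-- The normals: `e₂ + e₃` first, then the coordinate vectors indexed by `zset J₀`. -/
noncomputable def normals (J0 : Finset (Fin 24)) {k : ℕ} (hk : (zset J0).card = k) :
    Fin (k + 1) → EuclideanSpace ℝ (Fin 24) :=
  Fin.cases (toE 24 e23) fun i => toE 24 (e ((zset J0).orderEmbOfFin hk i))

/-- The normals are pairwise orthogonal and nonzero (for `J₀` avoiding `2, 3`), hence linearly independent. -/
theorem linearIndependent_normals (J0 : Finset (Fin 24)) (hJ : ∀ j ∈ J0, 4 ≤ j.val) {k : ℕ}
    (hk : (zset J0).card = k) : LinearIndependent ℝ (normals J0 hk) := by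
  have hz : ∀ i : Fin k, (2 : Fin 24) ≠ (zset J0).orderEmbOfFin hk i ∧ (3 : Fin 24) ≠ (zset J0).orderEmbOfFin hk i := by
    intro i
    have hm := (zset J0).orderEmbOfFin_mem hk i
    have h : 4 ≤ ((zset J0).orderEmbOfFin hk i).val ∨ ((zset J0).orderEmbOfFin hk i).val < 2 := by
      rcases Finset.mem_union.mp hm with h | h
      · exact Or.inr (Finset.mem_filter.mp h).2
      · exact Or.inl (hJ _ h)
    constructor
    · intro h2; rw [← h2] at h; revert h; decide
    · intro h3; rw [← h3] at h; revert h; decide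
  apply linearIndependent_of_ne_zero_of_inner_eq_zero
  · intro i h0
    rcases Fin.eq_zero_or_eq_succ i with rfl | ⟨i', rfl⟩
    · have hi := inner_toE (q := 24) (by norm_num) e23 e23
      simp only [normals, Fin.cases_zero] at h0
      rw [h0, inner_zero_left, ip_e23] at hi
      norm_num [e23] at hi
    · have hi := inner_toE (q := 24) (by norm_num) (e ((zset J0).orderEmbOfFin hk i'))
        (e ((zset J0).orderEmbOfFin hk i'))
      simp only [normals, Fin.cases_succ] at h0
      rw [h0, inner_zero_left, ip_e] at hi
      simp [e] at hi
  · intro i j hij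
    rcases Fin.eq_zero_or_eq_succ i with rfl | ⟨i', rfl⟩ <;>
      rcases Fin.eq_zero_or_eq_succ j with rfl | ⟨j', rfl⟩
    · exact absurd rfl hij
    · simp only [normals, Fin.cases_zero, Fin.cases_succ]
      rw [inner_toE (by norm_num), ip_e23]
      obtain ⟨h2, h3⟩ := hz j'
      simp [e, h2, h3]
    · simp only [normals, Fin.cases_zero, Fin.cases_succ]
      rw [inner_toE (by norm_num), ip_e]
      obtain ⟨h2, h3⟩ := hz i'
      simp [e23, Ne.symm h2, Ne.symm h3]
    · simp only [normals, Fin.cases_succ]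
      rw [inner_toE (by norm_num), ip_e]
      have hne : (zset J0).orderEmbOfFin hk i' ≠ (zset J0).orderEmbOfFin hk j' := by
        intro h; exact hij (by rw [((zset J0).orderEmbOfFin hk).injective h])
      simp [e, hne]

/-- The cut vectors are orthogonal to the normals. -/
theorem orth_pre (J0 : Finset (Fin 24)) {k : ℕ} (hk : (zset J0).card = k) :
    ∀ x ∈ pre J0, ∀ i, inner ℝ (normals J0 hk i) x = 0 := by
  intro x hx i
  obtain ⟨y, hy, rfl⟩ := mem_image.mp hx
  refine Fin.cases ?_ (fun i => ?_) i
  · simp only [normals, Fin.cases_zero]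
    rw [inner_toE (by norm_num), ip_e23_cut2 hy]
    simp
  · simp only [normals, Fin.cases_succ]
    rw [inner_toE (by norm_num), ip_e, cut2_apply_eq_zero hy ((zset J0).orderEmbOfFin_mem hk i)]
    simp

/-- **Generic row.** If `K₀` octads contain `0, 1` and avoid `{2, 3} ∪ J₀`, `K₂` octads contain `0, 1, 2, 3` and avoid
`J₀` (`J₀ ⊆ {4, …, 23}`), and `n + |{0,1} ∪ J₀| + 1 = 24`, then there are `32 K₀ + 16 K₂` unit vectors in `ℝⁿ` with
pairwise inner products `≤ 1/3`. [cite: ConwaySloane1999, Ch. 4 §11 (135)] -/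
theorem exists_code_third_pair_of_octads (J0 : Finset (Fin 24)) (hJ : ∀ j ∈ J0, 4 ≤ j.val) {K0 K2 k n : ℕ}
    (hK0 : (univ.filter fun o : Fin 759 => (((0 : Fin 24) ∈ osupp o ∧ (1 : Fin 24) ∈ osupp o) ∧
      ((2 : Fin 24) ∉ osupp o ∧ (3 : Fin 24) ∉ osupp o)) ∧ ∀ j ∈ J0, j ∉ osupp o).card = K0)
    (hK2 : (univ.filter fun o : Fin 759 => (((0 : Fin 24) ∈ osupp o ∧ (1 : Fin 24) ∈ osupp o) ∧
      ((2 : Fin 24) ∈ osupp o ∧ (3 : Fin 24) ∈ osupp o)) ∧ ∀ j ∈ J0, j ∉ osupp o).card = K2)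
    (hk : (zset J0).card = k) (hn : n + (k + 1) = 24) :
    ∃ C : Finset (EuclideanSpace ℝ (Fin n)),
      C.card = 32 * K0 + 16 * K2 ∧ (∀ x ∈ C, ‖x‖ = 1) ∧ (∀ x ∈ C, ∀ y ∈ C, x ≠ y → inner ℝ x y ≤ 1 / 3) := by
  obtain ⟨C', hc, hn', hi, _⟩ := exists_transfer_orthogonal (m := 24) (n := n) (k := k + 1) (by omega) _
    (linearIndependent_normals J0 hJ hk) (pre J0) (orth_pre J0 hk)
  refine ⟨C', by rw [hc, card_pre, card_sec J0 hK0 hK2], fun x' hx' => ?_, fun x' hx' y' hy' hne => ?_⟩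
  · obtain ⟨x, hx, he⟩ := hn' x' hx'
    rw [he]; exact norm_pre J0 x hx
  · obtain ⟨x, hx, y, hy, hxy, he⟩ := hi x' hx' y' hy' hne
    rw [he]; exact inner_pre J0 x hx y hy hxy

/-! ### The row `n = 17` -/

set_option maxRecDepth 100000 in
set_option maxHeartbeats 1000000 in
/-- **`A(17, arccos 1/3) ≥ 576`**: `J₀ = {4, 13, 15, 20}` (with `0, …, 3`: the octad `{0,1,2,3,4,13,15,20}`), `K₀ = 16`,
`K₂ = 4`, `32·16 + 16·4 = 576`. [cite: ConwaySloane1999, Ch. 4 §11 (135)] -/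
theorem exists_code_dim17_third_576 : ∃ C : Finset (EuclideanSpace ℝ (Fin 17)),
    C.card = 576 ∧ (∀ x ∈ C, ‖x‖ = 1) ∧ (∀ x ∈ C, ∀ y ∈ C, x ≠ y → inner ℝ x y ≤ 1 / 3) :=
  exists_code_third_pair_of_octads {4, 13, 15, 20} (by decide) (K0 := 16) (K2 := 4) (by decide +kernel)
    (by decide +kernel) (k := 6) (by decide +kernel) rfl


/-- **Sphere language, `ℝ¹⁸`, two touching unit spheres: at least `576`** further unit spheres with pairwise disjoint
interiors touch both (SPLAG Ch. 14 Thm 1 converse, `SphericalCodes.exists_touching_of_code` with `k = 1`).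
[cite: ConwaySloane1999, Ch. 14 Theorem 1] -/
theorem exists_touching_two_dim18_576 : ∃ a : Fin 2 → EuclideanSpace ℝ (Fin 18), (∀ i j, i ≠ j → ‖a i - a j‖ = 2) ∧
    ∃ S : Finset (EuclideanSpace ℝ (Fin 18)), S.card = 576 ∧ (∀ c ∈ S, ∀ i, ‖c - a i‖ = 2) ∧
      (∀ c ∈ S, ∀ c' ∈ S, c ≠ c' → 2 ≤ ‖c - c'‖) := by
  obtain ⟨C, hc, h1, h2⟩ := exists_code_dim17_third_576
  obtain ⟨a, ha, S, hS, hS1, hS2⟩ := SphericalCodes.exists_touching_of_code (k := 1) C h1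
    (fun x hx y hy hxy => (h2 x hx y hy hxy).trans_eq (by norm_num))
  exact ⟨a, ha, S, hS.trans hc, hS1, hS2⟩

end Summit.Ventures.PackingBounds.Config.Leech.PrefixThirdPair
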